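import Summits.FinalStateConjecture.FinalStateConjecture.Theorems.EIHFluxBalanceInertialRecessionVirialFiber

/-!
# Route EIHFluxBalance — crux `InertialRecession`, abstract endgame for general `N`:
# the virial error of one set over all its alive steps

Helper file for the crux `stmt-FinalStateConjecture-10166` (virial route; `InertialRecession_seat0_session8_note.md` §A).
Mathlib-only. Summing the fiber costs (`fiber_cost_le`) of one set `B` over the keyed blocks of its alive steps
(`abs_sum_alive_le`, `key_block`): every full block is paid by the WEIGHTS `w i = h ε_b(t_{i+1})`,
`ε_b = 3(K′ + 2δ₁)(C F_Φ + 2 F_ζ/δ₁)` (a RATE), and the at most one block cut by `n` by the JUNK `J = 3(K′+2δ₁)(Cδ₁+2)·2D_n`, `D_n` a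
bound for the diameter of the root at the final time (`perSet_cost_le`).
-/

noncomputable section

open Finset

namespace Summit.FinalStateConjecture.FinalStateConjecture.Theorems.SublinearIsFree.Virial

open Literature.Geometry.Lorentzian

variable {N : ℕ}

/-- **A block is short compared with its start time**: for a set qualifying at level `ℓ` at the grid time `t_s`
(`2^ℓ ≤ g ≤ 2κ²t_s` by the cone), `2^{ℓ−k₀} h ≤ δ c₀ t_s ≤ t_s`. [folklore] -/
theorem block_duration_le_start (ξ : Fin N → ℝ → E3) {κ δ c₀ h T : ℝ} {k₀ : ℕ} (hδ0 : 0 ≤ δ) (hδ1 : δ ≤ 1 / 10)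
    (hc₀1 : c₀ ≤ 1) (hh0 : 0 ≤ h) (hT : 0 < T) (hδ₁b : h / 2 ^ k₀ * (2 * κ ^ 2) ≤ δ * c₀)
    (hcone : ∀ (m : ℕ) (x : Fin N), ‖ξ x (T + m * h)‖ ≤ κ ^ 2 * (T + m * h))
    {B : Finset (Fin N)} {ℓ : ℕ} (hk₀ : k₀ ≤ ℓ) {s : ℕ} {g : ℝ}
    (hg : ∀ x ∈ B, ∀ z ∈ univ \ B, g ≤ ‖ξ x (T + s * h) - ξ z (T + s * h)‖)
    (hnear : ∃ x₀ ∈ B, ∃ z₀ ∈ univ \ B, ‖ξ x₀ (T + s * h) - ξ z₀ (T + s * h)‖ < 2 * g) (hℓg : (2 : ℝ) ^ ℓ ≤ g) :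
    (2 : ℝ) ^ (ℓ - k₀) * h ≤ T + s * h := by
  have ht0 : 0 < T + s * h := by positivity
  obtain ⟨x₀, hx₀, z₀, hz₀, -⟩ := hnear
  have hg2 : g ≤ 2 * κ ^ 2 * (T + s * h) := by
    have h0 := hg x₀ hx₀ z₀ hz₀
    have h1' : ‖ξ x₀ (T + s * h) - ξ z₀ (T + s * h)‖ ≤ ‖ξ x₀ (T + s * h)‖ + ‖ξ z₀ (T + s * h)‖ := norm_sub_le _ _
    linarith [hcone s x₀, hcone s z₀]
  have hblk : (2 : ℝ) ^ (ℓ - k₀) * h = 2 ^ ℓ * (h / 2 ^ k₀) := by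
    obtain ⟨e', rfl⟩ := Nat.exists_eq_add_of_le hk₀
    rw [Nat.add_sub_cancel_left, pow_add]; field_simp
  rw [hblk]
  have hδ₁0 : 0 ≤ h / 2 ^ k₀ := by positivity
  calc (2 : ℝ) ^ ℓ * (h / 2 ^ k₀) ≤ (2 * κ ^ 2 * (T + s * h)) * (h / 2 ^ k₀) :=
        mul_le_mul_of_nonneg_right (hℓg.trans hg2) hδ₁0
    _ = (T + s * h) * (h / 2 ^ k₀ * (2 * κ ^ 2)) := by ring
    _ ≤ (T + s * h) * (δ * c₀) := mul_le_mul_of_nonneg_left hδ₁b ht0.le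
    _ ≤ (T + s * h) * 1 := by
        refine mul_le_mul_of_nonneg_left ?_ ht0.le
        have : δ * c₀ ≤ δ * 1 := mul_le_mul_of_nonneg_left hc₀1 hδ0
        linarith
    _ = T + s * h := mul_one _

/-- **A full block is paid by the weights.** [folklore] -/
theorem full_block_paid (ξ v : Fin N → ℝ → E3) (M : Fin N → ℝ) (𝒦 : Finset (Fin N)) (hM : ∀ i, 0 < M i)
    {κ δ C c₀ Λ h T TL : ℝ} {k₀ L n : ℕ} (ζ rmin Fζ FΦ : ℝ → ℝ)
    (F : ℕ → Finset (Finset (Fin N))) (lev : ℕ → Finset (Fin N) → ℕ)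
    (parOf : Finset (Finset (Fin N)) → Finset (Fin N) → Finset (Fin N))
    (hFdef : ∀ i B, B ∈ F i ↔ B ⊂ 𝒦 ∧ B.Nonempty ∧ ∃ ℓ : ℕ, k₀ ≤ ℓ ∧ ℓ < L ∧ ∃ D g : ℝ,
      (∀ x ∈ B, ∀ y ∈ B, ‖ξ x (T + (2 ^ (ℓ - k₀) * (i / 2 ^ (ℓ - k₀)) : ℕ) * h) - ξ y (T + (2 ^ (ℓ - k₀) * (i / 2 ^ (ℓ - k₀)) : ℕ) * h)‖ ≤ D) ∧
      (∀ x ∈ B, ∀ z ∈ univ \ B, g ≤ ‖ξ x (T + (2 ^ (ℓ - k₀) * (i / 2 ^ (ℓ - k₀)) : ℕ) * h) - ξ z (T + (2 ^ (ℓ - k₀) * (i / 2 ^ (ℓ - k₀)) : ℕ) * h)‖) ∧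
      (∃ x₀ ∈ B, ∃ z₀ ∈ univ \ B, ‖ξ x₀ (T + (2 ^ (ℓ - k₀) * (i / 2 ^ (ℓ - k₀)) : ℕ) * h) - ξ z₀ (T + (2 ^ (ℓ - k₀) * (i / 2 ^ (ℓ - k₀)) : ℕ) * h)‖ < 2 * g) ∧
      Λ * D < g ∧ (2 : ℝ) ^ ℓ ≤ g ∧ g < (2 : ℝ) ^ (ℓ + 3))
    (hlev : ∀ i, ∀ B ∈ F i, k₀ ≤ lev i B ∧ lev i B < L ∧ ∃ D g : ℝ,
      (∀ x ∈ B, ∀ y ∈ B, ‖ξ x (T + (2 ^ (lev i B - k₀) * (i / 2 ^ (lev i B - k₀)) : ℕ) * h) - ξ y (T + (2 ^ (lev i B - k₀) * (i / 2 ^ (lev i B - k₀)) : ℕ) * h)‖ ≤ D) ∧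
      (∀ x ∈ B, ∀ z ∈ univ \ B, g ≤ ‖ξ x (T + (2 ^ (lev i B - k₀) * (i / 2 ^ (lev i B - k₀)) : ℕ) * h) - ξ z (T + (2 ^ (lev i B - k₀) * (i / 2 ^ (lev i B - k₀)) : ℕ) * h)‖) ∧
      (∃ x₀ ∈ B, ∃ z₀ ∈ univ \ B, ‖ξ x₀ (T + (2 ^ (lev i B - k₀) * (i / 2 ^ (lev i B - k₀)) : ℕ) * h) - ξ z₀ (T + (2 ^ (lev i B - k₀) * (i / 2 ^ (lev i B - k₀)) : ℕ) * h)‖ < 2 * g) ∧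
      Λ * D < g ∧ (2 : ℝ) ^ (lev i B) ≤ g ∧ g < (2 : ℝ) ^ ((lev i B) + 3))
    (hlevmax : ∀ i, ∀ B ∈ F i, ∀ ℓ, k₀ ≤ ℓ → ℓ < L → (∃ D g : ℝ,
      (∀ x ∈ B, ∀ y ∈ B, ‖ξ x (T + (2 ^ (ℓ - k₀) * (i / 2 ^ (ℓ - k₀)) : ℕ) * h) - ξ y (T + (2 ^ (ℓ - k₀) * (i / 2 ^ (ℓ - k₀)) : ℕ) * h)‖ ≤ D) ∧
      (∀ x ∈ B, ∀ z ∈ univ \ B, g ≤ ‖ξ x (T + (2 ^ (ℓ - k₀) * (i / 2 ^ (ℓ - k₀)) : ℕ) * h) - ξ z (T + (2 ^ (ℓ - k₀) * (i / 2 ^ (ℓ - k₀)) : ℕ) * h)‖) ∧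
      (∃ x₀ ∈ B, ∃ z₀ ∈ univ \ B, ‖ξ x₀ (T + (2 ^ (ℓ - k₀) * (i / 2 ^ (ℓ - k₀)) : ℕ) * h) - ξ z₀ (T + (2 ^ (ℓ - k₀) * (i / 2 ^ (ℓ - k₀)) : ℕ) * h)‖ < 2 * g) ∧
      Λ * D < g ∧ (2 : ℝ) ^ ℓ ≤ g ∧ g < (2 : ℝ) ^ (ℓ + 3)) → ℓ ≤ lev i B)
    (hparOf : ∀ (𝒩 𝒩' : Finset (Finset (Fin N))) (A : Finset (Fin N)),
      𝒩.filter (fun B ↦ A ⊂ B) = 𝒩'.filter (fun B ↦ A ⊂ B) → parOf 𝒩 A = parOf 𝒩' A)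
    (hpar₁ : ∀ i, ∀ A ∈ F i, A ⊂ parOf (F i) A) (hpar₂ : ∀ i, ∀ A ∈ F i, parOf (F i) A ∈ F i ∨ parOf (F i) A = 𝒦)
    (hpar₃ : ∀ i, ∀ A ∈ F i, ∀ B', (B' ∈ F i ∨ B' = 𝒦) → A ⊂ B' → parOf (F i) A ⊆ B')
    (hNode : ∀ (t R : ℝ) (c : E3) (A : Finset (Fin N)), TL ≤ t → 0 < R → R ≤ c₀ * t →
      min (rmin t / (2 * (1 + 3 * δ))) (c₀ * t) ≤ R → ‖c‖ ≤ κ ^ 2 * t →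
      (∀ j ∈ A, ‖ξ j t - c‖ ≤ (1 - 2 * δ) * R) → (∀ j ∉ A, (1 + 2 * δ) * R ≤ ‖ξ j t - c‖) →
      ∀ s' ∈ Set.Icc t (t + δ * R),
        ‖∑ j ∈ A, (M j * (√(1 - ‖v j s'‖ ^ 2))⁻¹) • v j s' - ∑ j ∈ A, (M j * (√(1 - ‖v j t‖ ^ 2))⁻¹) • v j t‖ ≤
          3 * (C * ((s' - t) * (R ^ (3 / 2 : ℝ))⁻¹) + ζ t + ζ s'))
    (hC : 0 ≤ C) (hδ : 0 < δ) (hδ1 : δ ≤ 1 / 10) (hΛ : 32 ≤ Λ) (hΛκ : 2 * κ ^ 2 ≤ Λ * ((1 - 2 * δ) * c₀)) (hc₀ : 0 < c₀)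
    (hh0 : 0 ≤ h) (hT : 0 < T) (hTL : TL ≤ T)
    (hδ₁a : h / 2 ^ k₀ ≤ δ / (1 + 3 * δ)) (hδ₁b : h / 2 ^ k₀ * (2 * κ ^ 2) ≤ δ * c₀) (hδ₁c : h / 2 ^ k₀ ≤ 1 / 16)
    (hδ₁d : h / 2 ^ k₀ * (Λ + 1) ≤ 1 / 4)
    (hcone : ∀ (m : ℕ) (x : Fin N), ‖ξ x (T + m * h)‖ ≤ κ ^ 2 * (T + m * h))
    (hrmin : ∀ (m : ℕ) (x y : Fin N), x ≠ y → rmin (T + m * h) ≤ ‖ξ x (T + m * h) - ξ y (T + m * h)‖)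
    (hrmin0 : ∀ m : ℕ, 0 < rmin (T + m * h))
    (hmove : ∀ x (m m' : ℕ), m ≤ m' → ‖ξ x (T + m' * h) - ξ x (T + m * h)‖ ≤ (m' - m) * h)
    (hL : ∀ i ≤ n, ∀ x y : Fin N, ‖ξ x (T + i * h) - ξ y (T + i * h)‖ < (2 : ℝ) ^ L)
    (hroot : ∀ m ≤ n, ∃ D G : ℝ, (∀ x ∈ 𝒦, ∀ y ∈ 𝒦, ‖ξ x (T + m * h) - ξ y (T + m * h)‖ ≤ D) ∧
      (∀ x ∈ 𝒦, ∀ z ∈ univ \ 𝒦, G ≤ ‖ξ x (T + m * h) - ξ z (T + m * h)‖) ∧ 1 * D < G)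
    (hFζ : ∀ s t : ℝ, T ≤ s → t / 2 ≤ s → ζ s ≤ Fζ t)
    (hFΦ : ∀ (m : ℕ) (t : ℝ), t / 2 ≤ T + m * h →
      (((1 + 3 * δ)⁻¹) ^ (3 / 2 : ℝ))⁻¹ * √2 * (√(rmin (T + m * h)))⁻¹ + 2 * κ ^ 2 * (c₀ ^ (3 / 2 : ℝ))⁻¹ * (√(T + m * h))⁻¹ ≤ FΦ t)
    (hc₀1 : c₀ ≤ 1) (hh : 0 < h) (hFζa : Antitone Fζ) (hFΦa : Antitone FΦ)
    {i : ℕ} (hin : i < n) {B : Finset (Fin N)} (hB : B ∈ F i) :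
    |∑ i' ∈ Ico (2 ^ (lev i B - k₀) * (i / 2 ^ (lev i B - k₀))) (2 ^ (lev i B - k₀) * (i / 2 ^ (lev i B - k₀)) + 2 ^ (lev i B - k₀)),
      inner ℝ (∑ j ∈ B, (M j * (√(1 - ‖v j (T + (i' + 1 : ℕ) * h)‖ ^ 2))⁻¹) • v j (T + (i' + 1 : ℕ) * h) -
          ∑ j ∈ B, (M j * (√(1 - ‖v j (T + i' * h)‖ ^ 2))⁻¹) • v j (T + i' * h))
        ((∑ k ∈ B, M k)⁻¹ • ∑ k ∈ B, M k • ξ k (T + (i' + 1 : ℕ) * h) -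
          (∑ k ∈ parOf (F i') B, M k)⁻¹ • ∑ k ∈ parOf (F i') B, M k • ξ k (T + (i' + 1 : ℕ) * h))| ≤
      ∑ i' ∈ Ico (2 ^ (lev i B - k₀) * (i / 2 ^ (lev i B - k₀))) (2 ^ (lev i B - k₀) * (i / 2 ^ (lev i B - k₀)) + 2 ^ (lev i B - k₀)),
        h * (3 * (96 * (4 * Λ + 2) ^ N + 2 * (h / 2 ^ k₀)) *
          (C * FΦ (T + (i' + 1 : ℕ) * h) + 2 * Fζ (T + (i' + 1 : ℕ) * h) / (h / 2 ^ k₀))) := by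
  obtain ⟨hk₀, -, D, g, -, hg, hnear, -, hℓg, -⟩ := hlev i B hB
  set ℓ : ℕ := lev i B with hℓ
  set d : ℕ := ℓ - k₀ with hd
  set s : ℕ := 2 ^ d * (i / 2 ^ d) with hs
  set K' : ℝ := 96 * (4 * Λ + 2) ^ N with hK'
  set δ₁ : ℝ := h / 2 ^ k₀ with hδ₁
  have hδ₁0 : 0 < δ₁ := by rw [hδ₁]; positivity
  have hK'0 : 0 ≤ K' := by
    have : (0 : ℝ) ≤ 4 * Λ + 2 := by linarith
    rw [hK']; positivity
  have hdur : (2 : ℝ) ^ d * h ≤ T + s * h :=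
    block_duration_le_start ξ hδ.le hδ1 hc₀1 hh0 hT hδ₁b hcone hk₀ hg hnear hℓg
  set te : ℝ := T + ((s + 2 ^ d : ℕ) : ℝ) * h with hte
  have hte' : te = T + s * h + (2 : ℝ) ^ d * h := by rw [hte]; push_cast; ring
  have htref : te / 2 ≤ T + (s : ℕ) * h := by rw [hte']; linarith
  have hcost := fiber_cost_le ξ v M 𝒦 hM ζ rmin Fζ FΦ F lev parOf hFdef hlev hlevmax hparOf hpar₁ hpar₂ hpar₃ hNode hC hδ hδ1 hΛ
    hΛκ hc₀ hh0 hT hTL hδ₁a hδ₁b hδ₁c hδ₁d hcone hrmin hrmin0 hmove hL hroot hFζ hFΦ hin hB (e := s + 2 ^ d) (Nat.le_add_right _ _)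
    le_rfl htref
  refine hcost.trans ?_
  -- each weight on the block is at least `h ε_b(te)`
  have hblk : (2 : ℝ) ^ d * h = 2 ^ ℓ * δ₁ := by
    rw [hd, hδ₁]
    obtain ⟨e', he'⟩ := Nat.exists_eq_add_of_le hk₀
    rw [he', Nat.add_sub_cancel_left, pow_add]; field_simp
  have hlow : ∀ i' ∈ Ico s (s + 2 ^ d),
      h * (3 * (K' + 2 * δ₁) * (C * FΦ te + 2 * Fζ te / δ₁)) ≤
        h * (3 * (K' + 2 * δ₁) * (C * FΦ (T + (i' + 1 : ℕ) * h) + 2 * Fζ (T + (i' + 1 : ℕ) * h) / δ₁)) := by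
    intro i' hi'
    obtain ⟨-, h2⟩ := Finset.mem_Ico.mp hi'
    have hti : T + ((i' + 1 : ℕ) : ℝ) * h ≤ te := by
      rw [hte]
      have : ((i' + 1 : ℕ) : ℝ) ≤ ((s + 2 ^ d : ℕ) : ℝ) := by exact_mod_cast h2
      nlinarith
    have h1 := hFΦa hti
    have h2' := hFζa hti
    have hc : 0 ≤ 3 * (K' + 2 * δ₁) := by positivity
    apply mul_le_mul_of_nonneg_left _ hh0
    apply mul_le_mul_of_nonneg_left _ hc
    have := div_le_div_of_nonneg_right (mul_le_mul_of_nonneg_left h2' (by norm_num : (0:ℝ) ≤ 2)) hδ₁0.le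
    nlinarith [mul_le_mul_of_nonneg_left h1 hC]
  have hsumlow := Finset.card_nsmul_le_sum _ _ _ hlow
  rw [Nat.card_Ico, Nat.add_sub_cancel_left, nsmul_eq_mul] at hsumlow
  refine le_trans (le_of_eq ?_) hsumlow
  have key : ∀ P Dh X Z : ℝ, Dh = P * δ₁ →
      3 * (K' + 2 * δ₁) * (C * δ₁ * X + 2 * Z) * P = Dh * (3 * (K' + 2 * δ₁) * (C * X + 2 * Z / δ₁)) := by
    intro P Dh X Z hDh
    subst hDh
    field_simp
  have hcast : ((2 ^ d : ℕ) : ℝ) = (2 : ℝ) ^ d := by push_cast; ring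
  rw [hcast, ← mul_assoc ((2 : ℝ) ^ d) h]
  exact key _ _ _ _ hblk

/-- **The block cut by `n` is paid by the junk.** [folklore] -/
theorem cut_block_paid (ξ v : Fin N → ℝ → E3) (M : Fin N → ℝ) (𝒦 : Finset (Fin N)) (hM : ∀ i, 0 < M i)
    {κ δ C c₀ Λ h T TL : ℝ} {k₀ L n : ℕ} (ζ rmin Fζ FΦ : ℝ → ℝ)
    (F : ℕ → Finset (Finset (Fin N))) (lev : ℕ → Finset (Fin N) → ℕ)
    (parOf : Finset (Finset (Fin N)) → Finset (Fin N) → Finset (Fin N))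
    (hFdef : ∀ i B, B ∈ F i ↔ B ⊂ 𝒦 ∧ B.Nonempty ∧ ∃ ℓ : ℕ, k₀ ≤ ℓ ∧ ℓ < L ∧ ∃ D g : ℝ,
      (∀ x ∈ B, ∀ y ∈ B, ‖ξ x (T + (2 ^ (ℓ - k₀) * (i / 2 ^ (ℓ - k₀)) : ℕ) * h) - ξ y (T + (2 ^ (ℓ - k₀) * (i / 2 ^ (ℓ - k₀)) : ℕ) * h)‖ ≤ D) ∧
      (∀ x ∈ B, ∀ z ∈ univ \ B, g ≤ ‖ξ x (T + (2 ^ (ℓ - k₀) * (i / 2 ^ (ℓ - k₀)) : ℕ) * h) - ξ z (T + (2 ^ (ℓ - k₀) * (i / 2 ^ (ℓ - k₀)) : ℕ) * h)‖) ∧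
      (∃ x₀ ∈ B, ∃ z₀ ∈ univ \ B, ‖ξ x₀ (T + (2 ^ (ℓ - k₀) * (i / 2 ^ (ℓ - k₀)) : ℕ) * h) - ξ z₀ (T + (2 ^ (ℓ - k₀) * (i / 2 ^ (ℓ - k₀)) : ℕ) * h)‖ < 2 * g) ∧
      Λ * D < g ∧ (2 : ℝ) ^ ℓ ≤ g ∧ g < (2 : ℝ) ^ (ℓ + 3))
    (hlev : ∀ i, ∀ B ∈ F i, k₀ ≤ lev i B ∧ lev i B < L ∧ ∃ D g : ℝ,
      (∀ x ∈ B, ∀ y ∈ B, ‖ξ x (T + (2 ^ (lev i B - k₀) * (i / 2 ^ (lev i B - k₀)) : ℕ) * h) - ξ y (T + (2 ^ (lev i B - k₀) * (i / 2 ^ (lev i B - k₀)) : ℕ) * h)‖ ≤ D) ∧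
      (∀ x ∈ B, ∀ z ∈ univ \ B, g ≤ ‖ξ x (T + (2 ^ (lev i B - k₀) * (i / 2 ^ (lev i B - k₀)) : ℕ) * h) - ξ z (T + (2 ^ (lev i B - k₀) * (i / 2 ^ (lev i B - k₀)) : ℕ) * h)‖) ∧
      (∃ x₀ ∈ B, ∃ z₀ ∈ univ \ B, ‖ξ x₀ (T + (2 ^ (lev i B - k₀) * (i / 2 ^ (lev i B - k₀)) : ℕ) * h) - ξ z₀ (T + (2 ^ (lev i B - k₀) * (i / 2 ^ (lev i B - k₀)) : ℕ) * h)‖ < 2 * g) ∧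
      Λ * D < g ∧ (2 : ℝ) ^ (lev i B) ≤ g ∧ g < (2 : ℝ) ^ ((lev i B) + 3))
    (hlevmax : ∀ i, ∀ B ∈ F i, ∀ ℓ, k₀ ≤ ℓ → ℓ < L → (∃ D g : ℝ,
      (∀ x ∈ B, ∀ y ∈ B, ‖ξ x (T + (2 ^ (ℓ - k₀) * (i / 2 ^ (ℓ - k₀)) : ℕ) * h) - ξ y (T + (2 ^ (ℓ - k₀) * (i / 2 ^ (ℓ - k₀)) : ℕ) * h)‖ ≤ D) ∧
      (∀ x ∈ B, ∀ z ∈ univ \ B, g ≤ ‖ξ x (T + (2 ^ (ℓ - k₀) * (i / 2 ^ (ℓ - k₀)) : ℕ) * h) - ξ z (T + (2 ^ (ℓ - k₀) * (i / 2 ^ (ℓ - k₀)) : ℕ) * h)‖) ∧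
      (∃ x₀ ∈ B, ∃ z₀ ∈ univ \ B, ‖ξ x₀ (T + (2 ^ (ℓ - k₀) * (i / 2 ^ (ℓ - k₀)) : ℕ) * h) - ξ z₀ (T + (2 ^ (ℓ - k₀) * (i / 2 ^ (ℓ - k₀)) : ℕ) * h)‖ < 2 * g) ∧
      Λ * D < g ∧ (2 : ℝ) ^ ℓ ≤ g ∧ g < (2 : ℝ) ^ (ℓ + 3)) → ℓ ≤ lev i B)
    (hparOf : ∀ (𝒩 𝒩' : Finset (Finset (Fin N))) (A : Finset (Fin N)),
      𝒩.filter (fun B ↦ A ⊂ B) = 𝒩'.filter (fun B ↦ A ⊂ B) → parOf 𝒩 A = parOf 𝒩' A)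
    (hpar₁ : ∀ i, ∀ A ∈ F i, A ⊂ parOf (F i) A) (hpar₂ : ∀ i, ∀ A ∈ F i, parOf (F i) A ∈ F i ∨ parOf (F i) A = 𝒦)
    (hpar₃ : ∀ i, ∀ A ∈ F i, ∀ B', (B' ∈ F i ∨ B' = 𝒦) → A ⊂ B' → parOf (F i) A ⊆ B')
    (hNode : ∀ (t R : ℝ) (c : E3) (A : Finset (Fin N)), TL ≤ t → 0 < R → R ≤ c₀ * t →
      min (rmin t / (2 * (1 + 3 * δ))) (c₀ * t) ≤ R → ‖c‖ ≤ κ ^ 2 * t →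
      (∀ j ∈ A, ‖ξ j t - c‖ ≤ (1 - 2 * δ) * R) → (∀ j ∉ A, (1 + 2 * δ) * R ≤ ‖ξ j t - c‖) →
      ∀ s' ∈ Set.Icc t (t + δ * R),
        ‖∑ j ∈ A, (M j * (√(1 - ‖v j s'‖ ^ 2))⁻¹) • v j s' - ∑ j ∈ A, (M j * (√(1 - ‖v j t‖ ^ 2))⁻¹) • v j t‖ ≤
          3 * (C * ((s' - t) * (R ^ (3 / 2 : ℝ))⁻¹) + ζ t + ζ s'))
    (hC : 0 ≤ C) (hδ : 0 < δ) (hδ1 : δ ≤ 1 / 10) (hΛ : 32 ≤ Λ) (hΛκ : 2 * κ ^ 2 ≤ Λ * ((1 - 2 * δ) * c₀)) (hc₀ : 0 < c₀)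
    (hh0 : 0 ≤ h) (hT : 0 < T) (hTL : TL ≤ T)
    (hδ₁a : h / 2 ^ k₀ ≤ δ / (1 + 3 * δ)) (hδ₁b : h / 2 ^ k₀ * (2 * κ ^ 2) ≤ δ * c₀) (hδ₁c : h / 2 ^ k₀ ≤ 1 / 16)
    (hδ₁d : h / 2 ^ k₀ * (Λ + 1) ≤ 1 / 4)
    (hcone : ∀ (m : ℕ) (x : Fin N), ‖ξ x (T + m * h)‖ ≤ κ ^ 2 * (T + m * h))
    (hrmin : ∀ (m : ℕ) (x y : Fin N), x ≠ y → rmin (T + m * h) ≤ ‖ξ x (T + m * h) - ξ y (T + m * h)‖)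
    (hrmin0 : ∀ m : ℕ, 0 < rmin (T + m * h))
    (hmove : ∀ x (m m' : ℕ), m ≤ m' → ‖ξ x (T + m' * h) - ξ x (T + m * h)‖ ≤ (m' - m) * h)
    (hL : ∀ i ≤ n, ∀ x y : Fin N, ‖ξ x (T + i * h) - ξ y (T + i * h)‖ < (2 : ℝ) ^ L)
    (hroot : ∀ m ≤ n, ∃ D G : ℝ, (∀ x ∈ 𝒦, ∀ y ∈ 𝒦, ‖ξ x (T + m * h) - ξ y (T + m * h)‖ ≤ D) ∧
      (∀ x ∈ 𝒦, ∀ z ∈ univ \ 𝒦, G ≤ ‖ξ x (T + m * h) - ξ z (T + m * h)‖) ∧ 1 * D < G)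
    (hFζ : ∀ s t : ℝ, T ≤ s → t / 2 ≤ s → ζ s ≤ Fζ t)
    (hFΦ : ∀ (m : ℕ) (t : ℝ), t / 2 ≤ T + m * h →
      (((1 + 3 * δ)⁻¹) ^ (3 / 2 : ℝ))⁻¹ * √2 * (√(rmin (T + m * h)))⁻¹ + 2 * κ ^ 2 * (c₀ ^ (3 / 2 : ℝ))⁻¹ * (√(T + m * h))⁻¹ ≤ FΦ t)
    (hc₀1 : c₀ ≤ 1) (hh : 0 < h)
    (hFζ0 : ∀ t, 0 ≤ Fζ t) (hFζ1 : ∀ t, Fζ t ≤ 1) (hFΦ0 : ∀ t, 0 ≤ FΦ t) (hFΦ1 : ∀ t, FΦ t ≤ 1)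
    {i : ℕ} (hin : i < n) {B : Finset (Fin N)} (hB : B ∈ F i)
    (hcut : n < 2 ^ (lev i B - k₀) * (i / 2 ^ (lev i B - k₀)) + 2 ^ (lev i B - k₀))
    {Dn : ℝ} (hDn : ∀ x ∈ 𝒦, ∀ y ∈ 𝒦, ‖ξ x (T + n * h) - ξ y (T + n * h)‖ ≤ Dn) :
    |∑ i' ∈ Ico (2 ^ (lev i B - k₀) * (i / 2 ^ (lev i B - k₀))) n, inner ℝ (∑ j ∈ B, (M j * (√(1 - ‖v j (T + (i' + 1 : ℕ) * h)‖ ^ 2))⁻¹) • v j (T + (i' + 1 : ℕ) * h) -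
          ∑ j ∈ B, (M j * (√(1 - ‖v j (T + i' * h)‖ ^ 2))⁻¹) • v j (T + i' * h))
        ((∑ k ∈ B, M k)⁻¹ • ∑ k ∈ B, M k • ξ k (T + (i' + 1 : ℕ) * h) -
          (∑ k ∈ parOf (F i') B, M k)⁻¹ • ∑ k ∈ parOf (F i') B, M k • ξ k (T + (i' + 1 : ℕ) * h))| ≤
      3 * (96 * (4 * Λ + 2) ^ N + 2 * (h / 2 ^ k₀)) * (C * (h / 2 ^ k₀) + 2) * (2 * Dn) := by
  obtain ⟨hBsub, hBne, -⟩ := (hFdef i B).mp hB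
  obtain ⟨hk₀, -, D, g, -, hg, hnear, -, hℓg, -⟩ := hlev i B hB
  set ℓ : ℕ := lev i B with hℓ
  set d : ℕ := ℓ - k₀ with hd
  set s : ℕ := 2 ^ d * (i / 2 ^ d) with hs
  set K' : ℝ := 96 * (4 * Λ + 2) ^ N with hK'
  set δ₁ : ℝ := h / 2 ^ k₀ with hδ₁
  have hδ₁0 : 0 < δ₁ := by rw [hδ₁]; positivity
  have hK'0 : 0 ≤ K' := by
    have : (0 : ℝ) ≤ 4 * Λ + 2 := by linarith
    rw [hK']; positivity
  have hsi : s ≤ i := blockStart_le _ _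
  have hsn : s ≤ n := hsi.trans hin.le
  have hdur : (2 : ℝ) ^ d * h ≤ T + s * h :=
    block_duration_le_start ξ hδ.le hδ1 hc₀1 hh0 hT hδ₁b hcone hk₀ hg hnear hℓg
  have hns : ((n : ℝ) - s) * h ≤ (2 : ℝ) ^ d * h := by
    refine mul_le_mul_of_nonneg_right ?_ hh0
    have : ((n : ℕ) : ℝ) ≤ ((s + 2 ^ d : ℕ) : ℝ) := by exact_mod_cast hcut.le
    push_cast at this; linarith
  have htref : (T + (n : ℝ) * h) / 2 ≤ T + (s : ℕ) * h := by nlinarith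
  have hcost := fiber_cost_le ξ v M 𝒦 hM ζ rmin Fζ FΦ F lev parOf hFdef hlev hlevmax hparOf hpar₁ hpar₂ hpar₃ hNode hC hδ hδ1 hΛ
    hΛκ hc₀ hh0 hT hTL hδ₁a hδ₁b hδ₁c hδ₁d hcone hrmin hrmin0 hmove hL hroot hFζ hFΦ hin hB (e := n) hsn hcut.le htref
  refine hcost.trans ?_
  -- `2^ℓ ≤ g ≤ 2 Dn`: the gap at the block start against the diameter at the end
  obtain ⟨x, hx⟩ := hBne
  obtain ⟨z, hz𝒦, hzB⟩ := Finset.exists_of_ssubset hBsub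
  have hgz : g ≤ ‖ξ x (T + s * h) - ξ z (T + s * h)‖ := hg x hx z (Finset.mem_sdiff.mpr ⟨Finset.mem_univ _, hzB⟩)
  have hmv := abs_dist_sub_dist_le_of_move (ξ := fun y ↦ ξ y (T + s * h)) (ξ' := fun y ↦ ξ y (T + n * h))
    (μ := ((n : ℝ) - s) * h) (fun y ↦ hmove y s n hsn) x z
  rw [abs_le] at hmv
  have hdz := hDn x (hBsub.1 hx) z hz𝒦
  have hblk : (2 : ℝ) ^ d * h = 2 ^ ℓ * δ₁ := by
    rw [hd, hδ₁]
    obtain ⟨e', he'⟩ := Nat.exists_eq_add_of_le hk₀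
    rw [he', Nat.add_sub_cancel_left, pow_add]; field_simp
  have hδ₁s : δ₁ ≤ 1 / 16 := hδ₁c
  have hg2D : (2 : ℝ) ^ ℓ ≤ 2 * Dn := by nlinarith
  -- bound the envelopes by `1`
  have h1 := hFΦ1 (T + n * h)
  have h2 := hFζ1 (T + n * h)
  have hc : 0 ≤ 3 * (K' + 2 * δ₁) := by positivity
  have hmid : C * δ₁ * FΦ (T + ↑n * h) + 2 * Fζ (T + ↑n * h) ≤ C * δ₁ + 2 := by
    nlinarith [mul_le_mul_of_nonneg_left h1 (mul_nonneg hC hδ₁0.le)]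
  have hmid0 : 0 ≤ C * δ₁ * FΦ (T + ↑n * h) + 2 * Fζ (T + ↑n * h) := by
    have := hFΦ0 (T + n * h); have := hFζ0 (T + n * h); positivity
  calc 3 * (K' + 2 * δ₁) * (C * δ₁ * FΦ (T + ↑n * h) + 2 * Fζ (T + ↑n * h)) * 2 ^ ℓ
      ≤ 3 * (K' + 2 * δ₁) * (C * δ₁ + 2) * 2 ^ ℓ := by
        apply mul_le_mul_of_nonneg_right _ (by positivity)
        exact mul_le_mul_of_nonneg_left hmid hc
    _ ≤ 3 * (K' + 2 * δ₁) * (C * δ₁ + 2) * (2 * Dn) := by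
        apply mul_le_mul_of_nonneg_left hg2D
        have : 0 ≤ C * δ₁ + 2 := by positivity
        positivity

/-- **The virial error of one set.** See the module docstring. [folklore] -/
theorem perSet_cost_le (ξ v : Fin N → ℝ → E3) (M : Fin N → ℝ) (𝒦 : Finset (Fin N)) (hM : ∀ i, 0 < M i)
    {κ δ C c₀ Λ h T TL : ℝ} {k₀ L n : ℕ} (ζ rmin Fζ FΦ : ℝ → ℝ)
    (F : ℕ → Finset (Finset (Fin N))) (lev : ℕ → Finset (Fin N) → ℕ)
    (parOf : Finset (Finset (Fin N)) → Finset (Fin N) → Finset (Fin N))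
    (hFdef : ∀ i B, B ∈ F i ↔ B ⊂ 𝒦 ∧ B.Nonempty ∧ ∃ ℓ : ℕ, k₀ ≤ ℓ ∧ ℓ < L ∧ ∃ D g : ℝ,
      (∀ x ∈ B, ∀ y ∈ B, ‖ξ x (T + (2 ^ (ℓ - k₀) * (i / 2 ^ (ℓ - k₀)) : ℕ) * h) - ξ y (T + (2 ^ (ℓ - k₀) * (i / 2 ^ (ℓ - k₀)) : ℕ) * h)‖ ≤ D) ∧
      (∀ x ∈ B, ∀ z ∈ univ \ B, g ≤ ‖ξ x (T + (2 ^ (ℓ - k₀) * (i / 2 ^ (ℓ - k₀)) : ℕ) * h) - ξ z (T + (2 ^ (ℓ - k₀) * (i / 2 ^ (ℓ - k₀)) : ℕ) * h)‖) ∧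
      (∃ x₀ ∈ B, ∃ z₀ ∈ univ \ B, ‖ξ x₀ (T + (2 ^ (ℓ - k₀) * (i / 2 ^ (ℓ - k₀)) : ℕ) * h) - ξ z₀ (T + (2 ^ (ℓ - k₀) * (i / 2 ^ (ℓ - k₀)) : ℕ) * h)‖ < 2 * g) ∧
      Λ * D < g ∧ (2 : ℝ) ^ ℓ ≤ g ∧ g < (2 : ℝ) ^ (ℓ + 3))
    (hlev : ∀ i, ∀ B ∈ F i, k₀ ≤ lev i B ∧ lev i B < L ∧ ∃ D g : ℝ,
      (∀ x ∈ B, ∀ y ∈ B, ‖ξ x (T + (2 ^ (lev i B - k₀) * (i / 2 ^ (lev i B - k₀)) : ℕ) * h) - ξ y (T + (2 ^ (lev i B - k₀) * (i / 2 ^ (lev i B - k₀)) : ℕ) * h)‖ ≤ D) ∧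
      (∀ x ∈ B, ∀ z ∈ univ \ B, g ≤ ‖ξ x (T + (2 ^ (lev i B - k₀) * (i / 2 ^ (lev i B - k₀)) : ℕ) * h) - ξ z (T + (2 ^ (lev i B - k₀) * (i / 2 ^ (lev i B - k₀)) : ℕ) * h)‖) ∧
      (∃ x₀ ∈ B, ∃ z₀ ∈ univ \ B, ‖ξ x₀ (T + (2 ^ (lev i B - k₀) * (i / 2 ^ (lev i B - k₀)) : ℕ) * h) - ξ z₀ (T + (2 ^ (lev i B - k₀) * (i / 2 ^ (lev i B - k₀)) : ℕ) * h)‖ < 2 * g) ∧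
      Λ * D < g ∧ (2 : ℝ) ^ (lev i B) ≤ g ∧ g < (2 : ℝ) ^ ((lev i B) + 3))
    (hlevmax : ∀ i, ∀ B ∈ F i, ∀ ℓ, k₀ ≤ ℓ → ℓ < L → (∃ D g : ℝ,
      (∀ x ∈ B, ∀ y ∈ B, ‖ξ x (T + (2 ^ (ℓ - k₀) * (i / 2 ^ (ℓ - k₀)) : ℕ) * h) - ξ y (T + (2 ^ (ℓ - k₀) * (i / 2 ^ (ℓ - k₀)) : ℕ) * h)‖ ≤ D) ∧
      (∀ x ∈ B, ∀ z ∈ univ \ B, g ≤ ‖ξ x (T + (2 ^ (ℓ - k₀) * (i / 2 ^ (ℓ - k₀)) : ℕ) * h) - ξ z (T + (2 ^ (ℓ - k₀) * (i / 2 ^ (ℓ - k₀)) : ℕ) * h)‖) ∧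
      (∃ x₀ ∈ B, ∃ z₀ ∈ univ \ B, ‖ξ x₀ (T + (2 ^ (ℓ - k₀) * (i / 2 ^ (ℓ - k₀)) : ℕ) * h) - ξ z₀ (T + (2 ^ (ℓ - k₀) * (i / 2 ^ (ℓ - k₀)) : ℕ) * h)‖ < 2 * g) ∧
      Λ * D < g ∧ (2 : ℝ) ^ ℓ ≤ g ∧ g < (2 : ℝ) ^ (ℓ + 3)) → ℓ ≤ lev i B)
    (hparOf : ∀ (𝒩 𝒩' : Finset (Finset (Fin N))) (A : Finset (Fin N)),
      𝒩.filter (fun B ↦ A ⊂ B) = 𝒩'.filter (fun B ↦ A ⊂ B) → parOf 𝒩 A = parOf 𝒩' A)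
    (hpar₁ : ∀ i, ∀ A ∈ F i, A ⊂ parOf (F i) A) (hpar₂ : ∀ i, ∀ A ∈ F i, parOf (F i) A ∈ F i ∨ parOf (F i) A = 𝒦)
    (hpar₃ : ∀ i, ∀ A ∈ F i, ∀ B', (B' ∈ F i ∨ B' = 𝒦) → A ⊂ B' → parOf (F i) A ⊆ B')
    (hNode : ∀ (t R : ℝ) (c : E3) (A : Finset (Fin N)), TL ≤ t → 0 < R → R ≤ c₀ * t →
      min (rmin t / (2 * (1 + 3 * δ))) (c₀ * t) ≤ R → ‖c‖ ≤ κ ^ 2 * t →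
      (∀ j ∈ A, ‖ξ j t - c‖ ≤ (1 - 2 * δ) * R) → (∀ j ∉ A, (1 + 2 * δ) * R ≤ ‖ξ j t - c‖) →
      ∀ s' ∈ Set.Icc t (t + δ * R),
        ‖∑ j ∈ A, (M j * (√(1 - ‖v j s'‖ ^ 2))⁻¹) • v j s' - ∑ j ∈ A, (M j * (√(1 - ‖v j t‖ ^ 2))⁻¹) • v j t‖ ≤
          3 * (C * ((s' - t) * (R ^ (3 / 2 : ℝ))⁻¹) + ζ t + ζ s'))
    (hC : 0 ≤ C) (hδ : 0 < δ) (hδ1 : δ ≤ 1 / 10) (hΛ : 32 ≤ Λ) (hΛκ : 2 * κ ^ 2 ≤ Λ * ((1 - 2 * δ) * c₀)) (hc₀ : 0 < c₀)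
    (hh0 : 0 ≤ h) (hT : 0 < T) (hTL : TL ≤ T)
    (hδ₁a : h / 2 ^ k₀ ≤ δ / (1 + 3 * δ)) (hδ₁b : h / 2 ^ k₀ * (2 * κ ^ 2) ≤ δ * c₀) (hδ₁c : h / 2 ^ k₀ ≤ 1 / 16)
    (hδ₁d : h / 2 ^ k₀ * (Λ + 1) ≤ 1 / 4)
    (hcone : ∀ (m : ℕ) (x : Fin N), ‖ξ x (T + m * h)‖ ≤ κ ^ 2 * (T + m * h))
    (hrmin : ∀ (m : ℕ) (x y : Fin N), x ≠ y → rmin (T + m * h) ≤ ‖ξ x (T + m * h) - ξ y (T + m * h)‖)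
    (hrmin0 : ∀ m : ℕ, 0 < rmin (T + m * h))
    (hmove : ∀ x (m m' : ℕ), m ≤ m' → ‖ξ x (T + m' * h) - ξ x (T + m * h)‖ ≤ (m' - m) * h)
    (hL : ∀ i ≤ n, ∀ x y : Fin N, ‖ξ x (T + i * h) - ξ y (T + i * h)‖ < (2 : ℝ) ^ L)
    (hroot : ∀ m ≤ n, ∃ D G : ℝ, (∀ x ∈ 𝒦, ∀ y ∈ 𝒦, ‖ξ x (T + m * h) - ξ y (T + m * h)‖ ≤ D) ∧
      (∀ x ∈ 𝒦, ∀ z ∈ univ \ 𝒦, G ≤ ‖ξ x (T + m * h) - ξ z (T + m * h)‖) ∧ 1 * D < G)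
    (hFζ : ∀ s t : ℝ, T ≤ s → t / 2 ≤ s → ζ s ≤ Fζ t)
    (hFΦ : ∀ (m : ℕ) (t : ℝ), t / 2 ≤ T + m * h →
      (((1 + 3 * δ)⁻¹) ^ (3 / 2 : ℝ))⁻¹ * √2 * (√(rmin (T + m * h)))⁻¹ + 2 * κ ^ 2 * (c₀ ^ (3 / 2 : ℝ))⁻¹ * (√(T + m * h))⁻¹ ≤ FΦ t)
    (hc₀1 : c₀ ≤ 1) (hh : 0 < h)
    (hFζ0 : ∀ t, 0 ≤ Fζ t) (hFζ1 : ∀ t, Fζ t ≤ 1) (hFΦ0 : ∀ t, 0 ≤ FΦ t) (hFΦ1 : ∀ t, FΦ t ≤ 1)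
    (hFζa : Antitone Fζ) (hFΦa : Antitone FΦ)
    (B : Finset (Fin N)) {Dn : ℝ} (hDn0 : 0 ≤ Dn) (hDn : ∀ x ∈ 𝒦, ∀ y ∈ 𝒦, ‖ξ x (T + n * h) - ξ y (T + n * h)‖ ≤ Dn) :
    |∑ i' ∈ (range n).filter (fun i ↦ B ∈ F i), inner ℝ (∑ j ∈ B, (M j * (√(1 - ‖v j (T + (i' + 1 : ℕ) * h)‖ ^ 2))⁻¹) • v j (T + (i' + 1 : ℕ) * h) -
          ∑ j ∈ B, (M j * (√(1 - ‖v j (T + i' * h)‖ ^ 2))⁻¹) • v j (T + i' * h))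
        ((∑ k ∈ B, M k)⁻¹ • ∑ k ∈ B, M k • ξ k (T + (i' + 1 : ℕ) * h) -
          (∑ k ∈ parOf (F i') B, M k)⁻¹ • ∑ k ∈ parOf (F i') B, M k • ξ k (T + (i' + 1 : ℕ) * h))| ≤
      ∑ i' ∈ (range n).filter (fun i ↦ B ∈ F i), h * (3 * (96 * (4 * Λ + 2) ^ N + 2 * (h / 2 ^ k₀)) *
          (C * FΦ (T + (i' + 1 : ℕ) * h) + 2 * Fζ (T + (i' + 1 : ℕ) * h) / (h / 2 ^ k₀))) +
      3 * (96 * (4 * Λ + 2) ^ N + 2 * (h / 2 ^ k₀)) * (C * (h / 2 ^ k₀) + 2) * (2 * Dn) := by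
  have hK'0 : (0 : ℝ) ≤ 96 * (4 * Λ + 2) ^ N := by
    have : (0 : ℝ) ≤ 4 * Λ + 2 := by linarith
    positivity
  have hδ₁0 : 0 < h / 2 ^ k₀ := by positivity
  have hJ : 0 ≤ 3 * (96 * (4 * Λ + 2) ^ N + 2 * (h / 2 ^ k₀)) * (C * (h / 2 ^ k₀) + 2) * (2 * Dn) := by positivity
  refine abs_sum_alive_le (Finset.filter_subset _ _)
    (fun i ↦ (lev i B - k₀, 2 ^ (lev i B - k₀) * (i / 2 ^ (lev i B - k₀)))) _ _ hJ ?_ ?_ ?_ ?_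
  · intro i _
    have := hFΦ0 (T + (i + 1 : ℕ) * h); have := hFζ0 (T + (i + 1 : ℕ) * h)
    positivity
  · exact key_block (Q := fun B ℓ s ↦ ∃ D g : ℝ,
      (∀ x ∈ B, ∀ y ∈ B, ‖ξ x (T + (s : ℕ) * h) - ξ y (T + (s : ℕ) * h)‖ ≤ D) ∧
      (∀ x ∈ B, ∀ z ∈ univ \ B, g ≤ ‖ξ x (T + (s : ℕ) * h) - ξ z (T + (s : ℕ) * h)‖) ∧
      (∃ x₀ ∈ B, ∃ z₀ ∈ univ \ B, ‖ξ x₀ (T + (s : ℕ) * h) - ξ z₀ (T + (s : ℕ) * h)‖ < 2 * g) ∧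
      Λ * D < g ∧ (2 : ℝ) ^ ℓ ≤ g ∧ g < (2 : ℝ) ^ (ℓ + 3)) hFdef hlev hlevmax B n
  · intro i hi _
    obtain ⟨hi', hB⟩ := Finset.mem_filter.mp hi
    exact full_block_paid ξ v M 𝒦 hM ζ rmin Fζ FΦ F lev parOf hFdef hlev hlevmax hparOf hpar₁ hpar₂ hpar₃ hNode hC hδ hδ1 hΛ
      hΛκ hc₀ hh0 hT hTL hδ₁a hδ₁b hδ₁c hδ₁d hcone hrmin hrmin0 hmove hL hroot hFζ hFΦ hc₀1 hh hFζa hFΦa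
      (Finset.mem_range.mp hi') hB
  · intro i hi hcut
    obtain ⟨hi', hB⟩ := Finset.mem_filter.mp hi
    exact cut_block_paid ξ v M 𝒦 hM ζ rmin Fζ FΦ F lev parOf hFdef hlev hlevmax hparOf hpar₁ hpar₂ hpar₃ hNode hC hδ hδ1 hΛ
      hΛκ hc₀ hh0 hT hTL hδ₁a hδ₁b hδ₁c hδ₁d hcone hrmin hrmin0 hmove hL hroot hFζ hFΦ hc₀1 hh hFζ0 hFζ1 hFΦ0 hFΦ1
      (Finset.mem_range.mp hi') hB hcut hDn

/-- Registered one-line form of `block_duration_le_start`. [folklore] -/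
theorem block_duration_le_start_of_cone : open Literature.Geometry.Lorentzian Finset in ∀ {N : ℕ} (ξ : Fin N → ℝ → E3) {κ δ c₀ h T : ℝ} {k₀ : ℕ}, 0 ≤ δ → δ ≤ 1 / 10 → c₀ ≤ 1 → 0 ≤ h → 0 < T → h / 2 ^ k₀ * (2 * κ ^ 2) ≤ δ * c₀ → (∀ (m : ℕ) (x : Fin N), ‖ξ x (T + m * h)‖ ≤ κ ^ 2 * (T + m * h)) → ∀ {B : Finset (Fin N)} {ℓ : ℕ}, k₀ ≤ ℓ → ∀ {s : ℕ} {g : ℝ}, (∀ x ∈ B, ∀ z ∈ univ \ B, g ≤ ‖ξ x (T + s * h) - ξ z (T + s * h)‖) → (∃ x₀ ∈ B, ∃ z₀ ∈ univ \ B, ‖ξ x₀ (T + s * h) - ξ z₀ (T + s * h)‖ < 2 * g) → (2 : ℝ) ^ ℓ ≤ g → (2 : ℝ) ^ (ℓ - k₀) * h ≤ T + s * h :=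
  fun ξ _ _ _ _ _ _ hδ0 hδ1 hc₀1 hh0 hT hδ₁b hcone _ _ hk₀ _ _ hg hnear hℓg ↦ block_duration_le_start ξ hδ0 hδ1 hc₀1 hh0 hT hδ₁b hcone hk₀ hg hnear hℓg

end Summit.FinalStateConjecture.FinalStateConjecture.Theorems.SublinearIsFree.Virial

end
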